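import Literature.NumberTheory.EllipticCurves.GreenbergVatsal2000.ResidualSelmerGroups
import Literature.NumberTheory.EllipticCurves.GreenbergVatsal2000.NonPrimitivePAdicLFunction
import Literature.NumberTheory.EllipticCurves.GreenbergVatsal2000.MultiplicativeLambda
import HarnessLib

/-!
# Greenberg–Vatsal 2000, §3 Thm. (3.11) + (28) + p. 43 (with §2 pp. 28–29): for the non-primitive
# `p`-adic `L`-function of `E` at an Eisenstein prime, `μ = 0` and
# `λ = dim H¹(ℚ_Σ/ℚ_∞, Φ) + dim U` — the ANALYTIC input of display (16)

HONEST FRAMING (BSD rank-`≤ 1` residual cell `b2b-bsdres`, home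
`run/shared/lean/b2b/bsd-rank1-residual/`, unit `b2b-bsdres-eisenstein-p2`, class X2): the cell
deletes the COMBINATION-SHAPED residual classes of the rank-`≤ 1` BSD formula from PUBLISHED
theorems only and TYPES the construction-shaped ones; this is not "finishing BSD". This file records
ONE published statement as a named fact (`def … : Prop`, nothing asserted; D-0014/D-0026) — a
READING FACT assembling Greenberg–Vatsal's §3 at the trivial character: Thm. (3.11) (the Eisenstein
congruence `L_{Σ₀}(E/ℚ,T) ≡ u·L(G,T) mod p`, whose proof treats `p ∣ M` explicitly), display (28)
(`L(G,T) = L_{Σ₀}(C,T)·L_{Σ₀}(D,T)`, Ferrero–Washington for each factor) and the first lines of p. 43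
("the `λ`-invariant of `L(G,T)` is `λ_{φ,Σ₀} + λ_{ψ,Σ₀}`; the two terms are the `O`-coranks of
`S^{Σ₀}_C(ℚ_∞)` and `S^{Σ₀}_D(ℚ_∞)`"), with the identification of those coranks as the residual
dimensions `dim H¹(ℚ_Σ/ℚ_∞, Φ)`, `dim U` (pp. 28–29, Props. (2.6)/(2.8), Cor. (2.3)) and the period
normalisation of p. 42 ("the canonical period is the real period of `E` up to a `p`-adic unit").
It is VERBATIM the type of the cell's typed input `Summit.…X2.GVAnalyticInput` (gen 17) in the
Literature twin vocabulary of `ResidualSelmerGroups.lean` (definitional bridge: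
`Summits/…/X2/GreenbergVatsalInputsOfFacts.lean`) — the second of the two remaining printed inputs
of the cell's kernel proof of GV Thm. (1.3) at a multiplicative prime (flag `GV00-mult-asserted`).

## Citation header (held text arXiv:math/9906215 = `paper:arxiv-math_9906215`; p0055 = p. 32,
## p0065 = p. 42, p0066 = p. 43, p0032 = p. 9, p0051–52 = pp. 28–29)

* §3 p. 32: "Let `E` be a modular elliptic curve of conductor `N`, and let `p` be a fixed odd prime.
  We assume that `E` has either good ordinary or multiplicative reduction at `p`".
* p. 42: "We assume that `ψ` is odd and unramified at `p`, or equivalently that `φ` is even and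
  ramified at `p`. In this case, the admissible sign is plus, and the canonical period is the real
  period of `E` (up to multiplication by a `p`-adic unit). Let `N` denote the level of `E` and let
  `Σ₀` denote any set of primes containing all primes `l ≠ p` dividing `N`, but not including `p`.
  … Then we clearly have `L(G,χ,T) = L_{Σ₀}(C,χ,T) L_{Σ₀}(D,χ,T)`. (28)"
* p. 43: "The `μ`-invariant of `L(G,χ,T)` is zero because that is true for each factor in (28).
  Also, the `λ`-invariant of `L(G,χ,T)` is equal to `λ_{χφ,Σ₀} + λ_{χψ,Σ₀}`. The two terms are the
  `O`-coranks of `S^{Σ₀}_{C⊗χ}(ℚ_∞)` and `S^{Σ₀}_{D⊗χ}(ℚ_∞)`, respectively. Theorem (1.3) is a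
  consequence of the congruence in the following theorem. We just take `χ` to be the trivial
  character. We then obtain that `λ^{anal}_{E,Σ₀} = λ_{φ,Σ₀} + λ_{ψ,Σ₀}` … The vanishing of
  `μ^{anal}_E` also follows from the congruence. … **Theorem (3.11)** Let `χ` be any even character.
  Then we have congruence `L_{Σ₀}(E/ℚ,χ,T) ≡ u L(G,χ,T) (mod πΛ)`, where `u` is a unit in `O`."
  Proof: "… If `(p, M) ≠ 1`, then `M` must be divisible by precisely the first power of `p`. In
  this case one can argue as follows. … Hida's determination of the ordinary Eisenstein series
  ([Hid85], Thm. 5.8)".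
* pp. 28–29 (Props. (2.6), (2.8), Cor. (2.3)): `λ_{φ,Σ₀} = dim H¹(ℚ_Σ/ℚ_∞, Φ)`,
  `λ_{ψ,Σ₀} = dim S^{Σ₀}_Ψ(ℚ_∞) = dim U` ("`S_A(ℚ_∞) = H¹_unr(ℚ_Σ/ℚ_∞, A)`", p. 29);
  p. 9: `L_{Σ₀}(E/ℚ,T) = L(E/ℚ,T) · ∏_{ℓ∈Σ₀} 𝒫_ℓ(T)` (tree: `nonPrimitivePAdicLFunction`,
  `eulerFactorProduct`).

## The tree's vocabulary (no new definition)

`E/ℚ` on a globally minimal model `W`, `p` odd of MULTIPLICATIVE reduction, `f` the newform of `W`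
(`IsNewformOf`), `κ` cyclotomic, `Φ₀ ≤ E[p]` a rational line ramified at `p` and even, `S₀ = Σ₀`
finite, `p ∉ S₀ ⊇` bad places `≠ p`; `ϖ ∈ ℚ` with `ϖ·Ω_E = Ω⁺_f` (GV's `L(E/ℚ,T)` is
Néron-normalised, display (3) p. 6, so `ϖ·L_f = L(E/ℚ,T)`); `L` = THE Mazur–Tate–Teitelbaum
function of `f` at `p ‖ N` (`IsSplitMultPAdicLFunctionOf` / `IsMultPAdicLFunctionOf f p (−1)`),
`b ∈ Λ` with `ι b = ϖ·L`; then `b · eulerFactorProduct W p S₀` represents `L_{Σ₀}(E/ℚ,T)` and the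
statement reads: it has unit content (`μ = 0`) and `p^{λ} = #H¹(ℚ_Σ/ℚ_∞, Φ) · #U`
(`residualLineH1`, `residualQuotSelmer` of `ResidualSelmerGroups.lean`; both are finite
`𝔽_p`-spaces, so "`p^λ = #·#`" is "`λ = dim + dim`").
-/

set_option autoImplicit false

noncomputable section

open scoped Classical AddSubgroup MatrixGroups ModularForm

open NumberField IsDedekindDomain Field WeierstrassCurve CongruenceSubgroup PowerSeries
open Literature.NumberTheory.EllipticCurves Literature.NumberTheory.GaloisRepresentations
  Literature.NumberTheory.EllipticCurves.ModularForms
  Literature.NumberTheory.EllipticCurves.Rank1Residual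

namespace Literature.NumberTheory.EllipticCurves.GreenbergVatsal2000

/-- **Greenberg–Vatsal 2000, §3 Thm. (3.11) + (28) + p. 43 at `χ = 1`: `μ(L_{Σ₀}(E/ℚ,T)) = 0` and
`λ(L_{Σ₀}(E/ℚ,T)) = dim H¹(ℚ_Σ/ℚ_∞, Φ) + dim U`.** Thm. (3.11): "`L_{Σ₀}(E/ℚ,χ,T) ≡ u L(G,χ,T)
(mod πΛ)`, where `u` is a unit"; (28): "`L(G,χ,T) = L_{Σ₀}(C,χ,T) L_{Σ₀}(D,χ,T)`"; p. 43: "The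
`μ`-invariant of `L(G,χ,T)` is zero because that is true for each factor in (28). Also, the
`λ`-invariant of `L(G,χ,T)` is equal to `λ_{χφ,Σ₀} + λ_{χψ,Σ₀}`. The two terms are the `O`-coranks
of `S^{Σ₀}_{C⊗χ}(ℚ_∞)` and `S^{Σ₀}_{D⊗χ}(ℚ_∞)` … We just take `χ` to be the trivial character. We
then obtain that `λ^{anal}_{E,Σ₀} = λ_{φ,Σ₀} + λ_{ψ,Σ₀}` … The vanishing of `μ^{anal}_E` also follows
from the congruence"; pp. 28–29: these coranks are `dim H¹(ℚ_Σ/ℚ_∞, Φ)` and `dim U`; p. 42: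
"`φ` even and ramified at `p` … the canonical period is the real period of `E` (up to
multiplication by a `p`-adic unit)"; §3 standing hypotheses p. 32 (`p` odd, good ordinary or
multiplicative); Thm. (3.11)'s proof treats `p ∣ M` ("divisible by precisely the first power of
`p` … Hida … Thm. 5.8"). TRANSCRIPTION (multiplicative case): for `E/ℚ` globally minimal, `p ≠ 2`
multiplicative, `κ` cyclotomic, `Φ₀` a rational line ramified at `p` and even, `f` the newform,
`S₀ ∌ p` finite ⊇ bad places `≠ p`, every `ϖ` with `ϖ·Ω_E = Ω⁺_f`, THE multiplicative MTT function
`L` of `f`, every `b ∈ Λ` with `ι b = ϖ·L`: `b·∏_{ℓ∈S₀}𝒫_ℓ` has unit content and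
`p^{ord_T(b·∏𝒫 mod p)} = #residualLineH1 · #residualQuotSelmer`. Definitionally the cell's typed
input `X2.GVAnalyticInput W p κ f S₀ Φ₀ hΦ` (gen 17). Named reading-fact; nothing asserted.
-- TODO(general form): GV prove the congruence for every even Dirichlet character `χ` (tame at `p`)
-- and for good ordinary `p` as well; only `χ = 1` at a multiplicative prime is filed, with the
-- identifications of p. 43 / pp. 28–29 / p. 42 folded in (no Kubota–Leopoldt `L(G,T)` in the tree).
[cite: GreenbergVatsal2000, §3 Thm. (3.11), (28) and p. 43, with p. 32, p. 42 and §2 pp. 28–29] -/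
def nonPrimitive_unitContent_and_lambda_eq_residual_of_lineRamifiedEven : Prop :=
  ∀ (W : WeierstrassCurve ℚ) [W.IsGloballyMinimal] [W.IsElliptic] (p : ℕ) [Fact p.Prime]
    (κ : ZpExtension ℚ p) {N : ℕ} [NeZero N] (f : CuspForm (Gamma0 N) 2)
    (S₀ : Finset (HeightOneSpectrum (𝓞 ℚ)))
    (Φ₀ : AddSubgroup (W.geomTorsion (p : ℤ))) (hΦ : IsRationalLine W p Φ₀),
    p ≠ 2 → W.HasMultiplicativeReductionAtPrime p → κ.IsCyclotomic →
    ¬ LineUnramifiedAt W p Φ₀ → LineEven W p Φ₀ → IsNewformOf W f →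
    (∀ v ∈ S₀, ((p : ℕ) : 𝓞 ℚ) ∉ v.asIdeal) →
    (∀ v : HeightOneSpectrum (𝓞 ℚ), v ∉ S₀ → ((p : ℕ) : 𝓞 ℚ) ∉ v.asIdeal →
      W.HasGoodReductionAt v) →
    ∀ (ϖ : ℚ), (ϖ : ℝ) * W.realPeriodRat = plusPeriod f →
    ∀ (L : PowerSeries ℚ_[p]),
      (W.HasSplitMultiplicativeReductionAtPrime p → IsSplitMultPAdicLFunctionOf f p L) →
      (¬ W.HasSplitMultiplicativeReductionAtPrime p → IsMultPAdicLFunctionOf f p (-1) L) →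
    ∀ (b : IwasawaAlgebra p),
      iwasawaToPowerSeries p b = PowerSeries.C ((ϖ : ℚ) : ℚ_[p]) * L →
      HasUnitContent (b * eulerFactorProduct W p S₀) ∧
        p ^ (PowerSeries.map (PadicInt.toZMod (p := p)) (b * eulerFactorProduct W p S₀)).order.toNat =
          Nat.card (residualLineH1 W p κ S₀ Φ₀ hΦ) * Nat.card (residualQuotSelmer W p κ S₀ Φ₀ hΦ)

end Literature.NumberTheory.EllipticCurves.GreenbergVatsal2000

end
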